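import Mathlib.Topology.Bases
import Mathlib.Topology.Compactness.Compact
import Mathlib.Order.Preorder.Chain
import HarnessLib

/-!
# A chain of closed sets without a least element has a strictly decreasing cofinal sequence

Topic: Topology (general), used by the chain-limit step of the minimiser scheme for planar
foliations (`PlanarFoliations/PatternMinimiser.lean`). In a second-countable space, let `S` be a
nonempty family of closed sets, totally ordered by inclusion, in which every member has a
strictly smaller member. Then **there is a sequence `A n ∈ S`, strictly decreasing, and cofinal:
every member of `S` contains some `A n`** (`exists_seq_strictAnti_cofinal`): the complements form an
open cover of their union with a countable subcover (Lindelöf), and one descends below the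
members of the subcover one at a time. Also the intersection of the sequence is the intersection
of the family (`iInter_seq_eq_sInter`).

All statements are [folklore].
-/

noncomputable section

open Set
open _root_.Topology

namespace Literature.Topology.PlanarFoliations

variable {α : Type*} [TopologicalSpace α] [SecondCountableTopology α]

/-- **A chain of closed sets without a least element has a strictly decreasing cofinal
sequence.** [folklore] -/
theorem exists_seq_strictAnti_cofinal {S : Set (Set α)} (hchain : IsChain (· ⊆ ·) S) (hne : S.Nonempty)
    (hclosed : ∀ A ∈ S, IsClosed A) (hnomin : ∀ A ∈ S, ∃ A' ∈ S, A' ⊂ A) :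
    ∃ A : ℕ → Set α, (∀ n, A n ∈ S) ∧ (∀ n, A (n + 1) ⊂ A n) ∧ ∀ B ∈ S, ∃ n, A n ⊆ B := by
  -- countable subcover of the complements
  obtain ⟨T, hTc, hTU⟩ := TopologicalSpace.isOpen_iUnion_countable (fun A : S ↦ ((A : Set α))ᶜ) fun A ↦ (hclosed A A.2).isOpen_compl
  obtain ⟨A₀, hA₀⟩ := hne
  -- an enumeration of the subcover (padded with `A₀`)
  have hTc' : (insert (⟨A₀, hA₀⟩ : S) T).Countable := hTc.insert _
  obtain ⟨t, ht⟩ := hTc'.exists_eq_range (insert_nonempty _ _)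
  -- a common strict lower bound of two members
  have hlower : ∀ A ∈ S, ∀ A' ∈ S, ∃ A'' ∈ S, A'' ⊂ A ∧ A'' ⊆ A' := by
    intro A hA A' hA'
    rcases eq_or_ne A A' with rfl | hne'
    · obtain ⟨A'', hA'', hlt⟩ := hnomin A hA
      exact ⟨A'', hA'', hlt, hlt.1⟩
    rcases hchain hA hA' hne' with h | h
    · obtain ⟨A'', hA'', hlt⟩ := hnomin A hA
      exact ⟨A'', hA'', hlt, hlt.1.trans h⟩
    · -- `A' ⊆ A`: a strict lower bound of `A'` is one of `A`
      obtain ⟨A'', hA'', hlt⟩ := hnomin A' hA'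
      exact ⟨A'', hA'', ⟨hlt.1.trans h, fun h3 ↦ hlt.2 (h.trans h3)⟩, hlt.1⟩
  choose! low hlowS hlowlt hlowle using hlower
  -- the sequence
  set A : ℕ → Set α := fun n ↦ Nat.rec A₀ (fun k Ak ↦ low Ak (t k : Set α)) n with hA
  have hA0 : A 0 = A₀ := rfl
  have hAsucc : ∀ n, A (n + 1) = low (A n) (t n : Set α) := fun n ↦ rfl
  have hAS : ∀ n, A n ∈ S := by
    intro n
    induction n with
    | zero => exact hA₀
    | succ n ih => rw [hAsucc]; exact hlowS _ ih _ (t n).2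
  refine ⟨A, hAS, fun n ↦ by rw [hAsucc]; exact hlowlt _ (hAS n) _ (t n).2, fun B hB ↦ ?_⟩
  -- cofinality: a point of `B` off a smaller member is off some member of the subcover
  obtain ⟨B', hB', hlt⟩ := hnomin B hB
  obtain ⟨z, hzB, hzB'⟩ := exists_of_ssubset hlt
  have hzU : z ∈ ⋃ A : S, ((A : Set α))ᶜ := mem_iUnion.2 ⟨⟨B', hB'⟩, hzB'⟩
  rw [← hTU] at hzU
  obtain ⟨C, hCT, hzC⟩ := mem_iUnion₂.1 hzU
  obtain ⟨k, hk⟩ : C ∈ range t := by rw [← ht]; exact mem_insert_of_mem _ hCT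
  refine ⟨k + 1, ?_⟩
  have hsub : A (k + 1) ⊆ (C : Set α) := by rw [hAsucc, ← hk]; exact hlowle _ (hAS k) _ (t k).2
  -- `A (k+1) ⊆ B` or `B ⊆ A (k+1) ⊆ C ∌ z ∈ B`
  rcases eq_or_ne (A (k + 1)) B with h | hne'
  · exact h.le
  rcases hchain (hAS (k + 1)) hB hne' with h | h
  · exact h
  · exact absurd (hsub (h hzB)) hzC

omit [TopologicalSpace α] [SecondCountableTopology α] in
/-- **The intersection of a cofinal sequence is the intersection of the family.** [folklore] -/
theorem iInter_seq_eq_sInter {S : Set (Set α)} {A : ℕ → Set α} (hAS : ∀ n, A n ∈ S) (hcof : ∀ B ∈ S, ∃ n, A n ⊆ B) :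
    ⋂ n, A n = ⋂₀ S := by
  apply Subset.antisymm
  · exact subset_sInter fun B hB ↦ by obtain ⟨n, hn⟩ := hcof B hB; exact (iInter_subset _ n).trans hn
  · exact subset_iInter fun n ↦ sInter_subset_of_mem (hAS n)

omit [TopologicalSpace α] [SecondCountableTopology α] in
/-- A strictly decreasing sequence is antitone. [folklore] -/
theorem antitone_of_ssubset_succ {A : ℕ → Set α} (h : ∀ n, A (n + 1) ⊂ A n) : Antitone A :=
  antitone_nat_of_succ_le fun n ↦ (h n).1

omit [SecondCountableTopology α] in
/-- **The intersection of a strictly decreasing sequence of nonempty compact closed sets is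
nonempty and compact.** [folklore] -/
theorem isCompact_nonempty_iInter {A : ℕ → Set α} (h : ∀ n, A (n + 1) ⊂ A n) (hne : ∀ n, (A n).Nonempty)
    (hcpt : ∀ n, IsCompact (A n)) (hcl : ∀ n, IsClosed (A n)) : (⋂ n, A n).Nonempty ∧ IsCompact (⋂ n, A n) :=
  ⟨IsCompact.nonempty_iInter_of_sequence_nonempty_isCompact_isClosed A (fun n ↦ (h n).1) hne (hcpt 0) hcl,
    (hcpt 0).of_isClosed_subset (isClosed_iInter hcl) (iInter_subset _ 0)⟩

end Literature.Topology.PlanarFoliations
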